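import Mathlib.Algebra.Group.Pi.Lemmas
import Mathlib.Data.Set.Finite.Basic
import Mathlib.Data.Finset.Lattice.Fold
import Literature.AlgebraicGeometry.Frobenioids.PerfFactorialPrimes
import Literature.AnabelianGeometry.EtaleTheta.MonoprimeStructure
import HarnessLib

/-!
# Frobenioids I, §0 / Def. 2.4 (i) / Ex. 6.1, 6.3: direct sums `⊕_i M_i` of monoprime monoids — structure

Mochizuki, *The geometry of Frobenioids I*, Kyushu J. Math. **62** (2008), §0 pp. 10–12 (sharp, integral,
saturated, primes, monoprime), Def. 2.4 (i) p. 47 (perf-factorial), and the divisor monoids of the motivating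
examples: Ex. 6.1 p. 109 "one verifies immediately that `Φ(L)` is perf-factorial", Ex. 6.3 p. 113
"Thus [cf. §0], `Φ(L)` (`≠ 0`) is perf-factorial" [cite: MochizukiFrdI2008, Def. 2.4(i) p.47]
[cite: MochizukiFrdI2008, Ex. 6.3 p.113].

These divisor monoids are DIRECT SUMS of monoprime monoids (`ℤ_{≥0}`, `ℝ_{≥0}`, …).  This file sets up, in
the tree's multiplicative notation, the direct sum `directSum M ⊆ ∏_i M i` (finitely supported families) of a
family of commutative monoids `M i` and proves, for MONOPRIME factors, the §0 structure that Def. 2.4 (i)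
needs: componentwise divisibility, `f ≼ g ↔ supp f ⊆ supp g`, and that `⊕_i M_i` is DIVISORIAL.  Primes, the
localizations `(⊕ M)_𝔭 ≅ M_i` and perf-factoriality follow in `DirectSumPrimes.lean`,
`DirectSumFactorization.lean`, `DirectSumPerfFactorial.lean`.  Two small §0 facts about a monoprime monoid
`N ≅ Λ_{≥0}` are used on the way: divisibility is total (`PerfFactorialPrimes.lean`), and `a^n = c · b^n ⇒ b ≤ a`.
Seat abc-iut-L1-d2 (cell abc-iut); sub-DAG row FrdI:Thm6.4(i)/T64i-L02 (perf-factoriality of `Φ(L)`).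
-/

noncomputable section

namespace Literature.AlgebraicGeometry.Frobenioids

open Function Literature.AnabelianGeometry.EtaleTheta

universe u v

/-! ### A §0 fact about monoprime monoids (divisibility is total: `IsMonoprime.dvd_total`, t14) -/

namespace IsMonoprime

variable {N : Type u} [CommMonoid N]

/-- In a monoprime monoid, `a^n = c · b^n` with `n ≥ 1` forces `b ≤ a` (additively: `n a = c + n b ⇒ b ≤ a`).
[cite: MochizukiFrdI2008, §0 p.11] -/
theorem dvd_of_pow_eq_mul_pow (hN : IsMonoprime N) {a b c : N} {n : ℕ} (hn : 0 < n)
    (h : a ^ n = c * b ^ n) : b ∣ a := by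
  rcases dvd_total hN b a with hba | ⟨d, rfl⟩
  · exact hba
  · haveI := MonoprimeStructure.isCancelMul hN
    have h1 : a ^ n * (c * d ^ n) = a ^ n * 1 := by
      rw [mul_one, mul_left_comm, ← mul_pow]
      exact h.symm
    have h2 : c * d ^ n = 1 := mul_left_cancel h1
    have hd : d ^ n = 1 :=
      (MonoprimeStructure.isSharp hN).1 _ (IsUnit.of_mul_eq_one _ (by rw [mul_comm]; exact h2))
    rw [(MonoprimeStructure.isSharp hN).isTorsionFree.1 d n hn hd, mul_one]

end IsMonoprime

/-! ### A divisoriality criterion (multiplicative form of the additive one in `ArithmeticFrobenioidHypotheses`) -/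

/-- A sharp cancellative monoid in which `a^n = c · b^n` (`n ≥ 1`) forces `b ∣ a` is DIVISORIAL (integral,
saturated, of characteristic type, sharp — Def. 1.1 (i) / §0 p. 11). [cite: MochizukiFrdI2008, §0 p.11] -/
theorem isDivisorial_of_dvd_of_pow {L : Type u} [CommMonoid L] [IsCancelMul L] (hsharp : IsSharp L)
    (hsat : ∀ (a b c : L) (n : ℕ), 0 < n → a ^ n = c * b ^ n → b ∣ a) : IsDivisorial L := by
  refine ⟨⟨⟨Algebra.GrothendieckGroup.of_injective⟩, ⟨fun x n hn ⟨c, hc⟩ => ?_⟩,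
    ⟨fun u _ _ => Units.ext (hsharp.1 (u : L) u.isUnit)⟩⟩, hsharp⟩
  obtain ⟨⟨a, b⟩, h⟩ := (Localization.monoidOf (⊤ : Submonoid L)).surj x
  have hb : x = Algebra.GrothendieckGroup.of a / Algebra.GrothendieckGroup.of (b : L) :=
    eq_div_iff_mul_eq'.mpr h
  have hab : a ^ n = c * (b : L) ^ n := by
    apply Algebra.GrothendieckGroup.of_injective
    rw [map_mul, map_pow, map_pow, hc, hb, div_pow, div_mul_cancel]
  obtain ⟨d, hd⟩ := hsat _ _ _ n hn hab
  refine ⟨d, ?_⟩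
  rw [hb, eq_div_iff_mul_eq', ← map_mul, mul_comm, ← hd]

/-! ### The direct sum `⊕_i M_i ⊆ ∏_i M_i` -/

section DirectSum

variable {ι : Type u} {M : ι → Type v} [∀ i, CommMonoid (M i)]

/-- The support `{i | f_i ≠ 0}` (multiplicatively `≠ 1`) of a family. [cite: MochizukiFrdI2008, Ex. 6.3 p.113] -/
def dsupp (f : ∀ i, M i) : Set ι := {i | f i ≠ 1}

/-- Membership in the support. [cite: MochizukiFrdI2008, Ex. 6.3 p.113] -/
@[simp] theorem mem_dsupp_iff (f : ∀ i, M i) (i : ι) : i ∈ dsupp f ↔ f i ≠ 1 := Iff.rfl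

/-- `supp 1 = ∅`. [cite: MochizukiFrdI2008, Ex. 6.3 p.113] -/
@[simp] theorem dsupp_one : dsupp (1 : ∀ i, M i) = ∅ :=
  Set.eq_empty_iff_forall_notMem.mpr fun _ h => h rfl

/-- `supp (f g) ⊆ supp f ∪ supp g`. [cite: MochizukiFrdI2008, Ex. 6.3 p.113] -/
theorem dsupp_mul_subset (f g : ∀ i, M i) : dsupp (f * g) ⊆ dsupp f ∪ dsupp g := by
  intro i hi
  by_contra h
  simp only [Set.mem_union, mem_dsupp_iff, not_or, not_not] at h
  exact hi (by rw [Pi.mul_apply, h.1, h.2, mul_one])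

/-- `supp (f^n) ⊆ supp f`. [cite: MochizukiFrdI2008, Ex. 6.3 p.113] -/
theorem dsupp_pow_subset (f : ∀ i, M i) (n : ℕ) : dsupp (f ^ n) ⊆ dsupp f := by
  intro i hi hfi
  exact hi (by rw [Pi.pow_apply, hfi, one_pow])

variable (M) in
/-- **The direct sum `⊕_i M_i`** of a family of commutative monoids: the submonoid of `∏_i M_i` of finitely
supported families (multiplicative rendering of the `⊕` of Ex. 6.1 / Ex. 6.3).
[cite: MochizukiFrdI2008, Ex. 6.3 p.113] -/
def directSum : Submonoid (∀ i, M i) where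
  carrier := {f | (dsupp f).Finite}
  one_mem' := by
    show (dsupp (1 : ∀ i, M i)).Finite
    rw [dsupp_one]
    exact Set.finite_empty
  mul_mem' {f g} hf hg := (hf.union hg).subset (dsupp_mul_subset f g)

namespace DirectSum

/-- Membership in `⊕_i M_i`: finite support. [cite: MochizukiFrdI2008, Ex. 6.3 p.113] -/
theorem mem_iff (f : ∀ i, M i) : f ∈ directSum M ↔ (dsupp f).Finite := Iff.rfl

/-- The support of an element of `⊕_i M_i` is finite. [cite: MochizukiFrdI2008, Ex. 6.3 p.113] -/
theorem finite_dsupp (f : directSum M) : (dsupp (f : ∀ i, M i)).Finite := f.2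

/-- Components of a product. [cite: MochizukiFrdI2008, Ex. 6.3 p.113] -/
@[simp] theorem coe_mul (f g : directSum M) : ((f * g : directSum M) : ∀ i, M i) = (f : ∀ i, M i) * g := rfl

/-- Components of `1`. [cite: MochizukiFrdI2008, Ex. 6.3 p.113] -/
@[simp] theorem coe_one : ((1 : directSum M) : ∀ i, M i) = 1 := rfl

/-- Components of a power. [cite: MochizukiFrdI2008, Ex. 6.3 p.113] -/
@[simp] theorem coe_pow (f : directSum M) (n : ℕ) : ((f ^ n : directSum M) : ∀ i, M i) = (f : ∀ i, M i) ^ n := rfl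

variable [DecidableEq ι]

/-- The element of `⊕_i M_i` supported at `i` with value `a` (`Pi.mulSingle`). [cite: MochizukiFrdI2008, Ex. 6.3 p.113] -/
def single (i : ι) (a : M i) : directSum M :=
  ⟨Pi.mulSingle i a, (Set.finite_singleton i).subset fun j hj => by
    by_contra hji
    exact hj (Pi.mulSingle_eq_of_ne hji a)⟩

/-- `single i a` at `i`. [cite: MochizukiFrdI2008, Ex. 6.3 p.113] -/
@[simp] theorem single_apply_same (i : ι) (a : M i) : (single i a : ∀ j, M j) i = a :=
  Pi.mulSingle_eq_same i a

/-- `single i a` off `i`. [cite: MochizukiFrdI2008, Ex. 6.3 p.113] -/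
theorem single_apply_of_ne {i j : ι} (h : j ≠ i) (a : M i) : (single i a : ∀ j, M j) j = 1 :=
  Pi.mulSingle_eq_of_ne h a

/-- `supp (single i a) ⊆ {i}`. [cite: MochizukiFrdI2008, Ex. 6.3 p.113] -/
theorem dsupp_single_subset (i : ι) (a : M i) : dsupp (single i a : ∀ j, M j) ⊆ {i} := fun j hj => by
  by_contra hji
  exact hj (single_apply_of_ne hji a)

/-- `supp (single i a) = {i}` for `a ≠ 1`. [cite: MochizukiFrdI2008, Ex. 6.3 p.113] -/
theorem dsupp_single {i : ι} {a : M i} (ha : a ≠ 1) : dsupp (single i a : ∀ j, M j) = {i} :=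
  Set.Subset.antisymm (dsupp_single_subset i a)
    (Set.singleton_subset_iff.mpr (by rw [mem_dsupp_iff, single_apply_same]; exact ha))

/-- `single i` is multiplicative. [cite: MochizukiFrdI2008, Ex. 6.3 p.113] -/
theorem single_mul (i : ι) (a b : M i) : single i (a * b) = single i a * single i b :=
  Subtype.ext (Pi.mulSingle_mul i a b)

/-- `single i 1 = 1`. [cite: MochizukiFrdI2008, Ex. 6.3 p.113] -/
@[simp] theorem single_one (i : ι) : single i (1 : M i) = 1 := Subtype.ext (Pi.mulSingle_one i)

omit [DecidableEq ι] in
/-- An element of `⊕_i M_i` is `1` iff its support is empty. [cite: MochizukiFrdI2008, Ex. 6.3 p.113] -/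
theorem eq_one_iff_dsupp_eq_empty (f : directSum M) : f = 1 ↔ dsupp (f : ∀ i, M i) = ∅ := by
  constructor
  · rintro rfl
    exact dsupp_one
  · intro h
    apply Subtype.ext
    funext i
    by_contra hi
    exact (Set.eq_empty_iff_forall_notMem.mp h) i hi

omit [DecidableEq ι] in
/-- An element of `⊕_i M_i` is `≠ 1` iff its support is nonempty. [cite: MochizukiFrdI2008, Ex. 6.3 p.113] -/
theorem ne_one_iff_dsupp_nonempty (f : directSum M) : f ≠ 1 ↔ (dsupp (f : ∀ i, M i)).Nonempty := by
  rw [ne_eq, eq_one_iff_dsupp_eq_empty, Set.nonempty_iff_ne_empty]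

/-- An element supported inside `{i}` is `single i` of its `i`-component. [cite: MochizukiFrdI2008, Ex. 6.3 p.113] -/
theorem eq_single_of_dsupp_subset {f : directSum M} {i : ι} (h : dsupp (f : ∀ j, M j) ⊆ {i}) :
    f = single i ((f : ∀ j, M j) i) := by
  apply Subtype.ext
  funext j
  by_cases hji : j = i
  · subst hji
    rw [single_apply_same]
  · rw [single_apply_of_ne hji]
    by_contra hfj
    exact hji (h hfj)

/-! ### Sharpness, cancellation, divisibility -/

omit [DecidableEq ι] in
/-- `⊕_i M_i` is sharp when all `M_i` are. [cite: MochizukiFrdI2008, §0 p.11] -/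
theorem isSharp (hM : ∀ i, IsSharp (M i)) : IsSharp (directSum M) := by
  refine ⟨fun f hf => ?_⟩
  obtain ⟨g, hfg⟩ := hf.exists_right_inv
  apply Subtype.ext
  funext i
  have h : (f : ∀ i, M i) i * (g : ∀ i, M i) i = 1 := by
    rw [← Pi.mul_apply, ← coe_mul, hfg, coe_one, Pi.one_apply]
  exact (hM i).1 _ (IsUnit.of_mul_eq_one _ h)

omit [DecidableEq ι] in
/-- `⊕_i M_i` is cancellative when all `M_i` are. [cite: MochizukiFrdI2008, §0 p.11] -/
theorem isCancelMul (hM : ∀ i, IsCancelMul (M i)) : IsCancelMul (directSum M) where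
  mul_left_cancel f := by
    intro g g' h
    apply Subtype.ext; funext i
    have := congrArg (fun z : directSum M => (z : ∀ i, M i) i) h
    simp only [coe_mul, Pi.mul_apply] at this
    exact mul_left_cancel this
  mul_right_cancel f := by
    intro g g' h
    apply Subtype.ext; funext i
    have := congrArg (fun z : directSum M => (z : ∀ i, M i) i) h
    simp only [coe_mul, Pi.mul_apply] at this
    exact mul_right_cancel this

omit [DecidableEq ι] in
/-- **Divisibility in `⊕_i M_i` is componentwise** (for sharp factors: the componentwise quotient is again
finitely supported). [cite: MochizukiFrdI2008, §0 p.12] -/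
theorem dvd_iff (hM : ∀ i, IsSharp (M i)) (f g : directSum M) :
    f ∣ g ↔ ∀ i, (f : ∀ i, M i) i ∣ (g : ∀ i, M i) i := by
  constructor
  · rintro ⟨c, rfl⟩ i
    exact ⟨(c : ∀ i, M i) i, rfl⟩
  · intro h
    choose c hc using h
    have hgc : (g : ∀ i, M i) = (f : ∀ i, M i) * c := funext hc
    have hcmem : c ∈ directSum M := by
      refine (finite_dsupp g).subset fun i hi => ?_
      by_contra hgi
      rw [mem_dsupp_iff, not_not] at hgi
      have h1 : (f : ∀ i, M i) i * c i = 1 := by rw [← hc, hgi]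
      exact hi ((hM i).1 _ (IsUnit.of_mul_eq_one _ (by rw [mul_comm]; exact h1)))
    exact ⟨⟨c, hcmem⟩, Subtype.ext hgc⟩

omit [DecidableEq ι] in
/-- `f ≼ g` in `⊕_i M_i` iff `∃ n ≥ 1, f_i ≤ n · g_i` for all `i`. [cite: MochizukiFrdI2008, §0 p.12] -/
theorem precsim_iff (hM : ∀ i, IsSharp (M i)) (f g : directSum M) :
    f ≼ g ↔ ∃ n : ℕ, 0 < n ∧ ∀ i, (f : ∀ i, M i) i ∣ (g : ∀ i, M i) i ^ n := by
  simp only [Precsim, dvd_iff hM, coe_pow, Pi.pow_apply]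

omit [DecidableEq ι] in
/-- `f ∣ g` in `⊕_i M_i` implies `supp f ⊆ supp g` (sharp factors). [cite: MochizukiFrdI2008, §0 p.12] -/
theorem dsupp_subset_of_dvd (hM : ∀ i, IsSharp (M i)) {f g : directSum M} (h : f ∣ g) :
    dsupp (f : ∀ i, M i) ⊆ dsupp (g : ∀ i, M i) := by
  intro i hi hgi
  rw [dvd_iff hM] at h
  obtain ⟨c, hc⟩ := h i
  rw [hgi] at hc
  exact hi ((hM i).1 _ (IsUnit.of_mul_eq_one _ hc.symm))

omit [DecidableEq ι] in
/-- `f ≼ g` in `⊕_i M_i` implies `supp f ⊆ supp g` (sharp factors). [cite: MochizukiFrdI2008, §0 p.12] -/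
theorem dsupp_subset_of_precsim (hM : ∀ i, IsSharp (M i)) {f g : directSum M} (h : f ≼ g) :
    dsupp (f : ∀ i, M i) ⊆ dsupp (g : ∀ i, M i) := by
  obtain ⟨n, -, h⟩ := h
  exact (dsupp_subset_of_dvd hM h).trans (dsupp_pow_subset (g : ∀ i, M i) n)

/-! ### Monoprime factors: `≼` is support inclusion; `⊕_i M_i` is divisorial -/

omit [DecidableEq ι] in
/-- For monoprime factors: `f ≼ g` iff `supp f ⊆ supp g` (each `M_i` is archimedean: `a ≼ b` for every
non-unit `b`; the exponents over the finite support are bounded). [cite: MochizukiFrdI2008, §0 p.12] -/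
theorem precsim_iff_dsupp_subset (hM : ∀ i, IsMonoprime (M i)) (f g : directSum M) :
    f ≼ g ↔ dsupp (f : ∀ i, M i) ⊆ dsupp (g : ∀ i, M i) := by
  have hsh : ∀ i, IsSharp (M i) := fun i => MonoprimeStructure.isSharp (hM i)
  refine ⟨dsupp_subset_of_precsim hsh, fun hsub => ?_⟩
  have hex : ∀ i, ∃ n : ℕ, 0 < n ∧ (f : ∀ i, M i) i ∣ (g : ∀ i, M i) i ^ n := by
    intro i
    by_cases hfi : (f : ∀ i, M i) i = 1
    · exact ⟨1, one_pos, by rw [hfi]; exact one_dvd _⟩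
    · exact MonoprimeStructure.precsim_of_ne_one (hM i) (hsub hfi)
  choose n hn hdvd using hex
  refine (precsim_iff hsh f g).mpr ⟨(finite_dsupp f).toFinset.sup n + 1, Nat.succ_pos _, fun i => ?_⟩
  by_cases hfi : (f : ∀ i, M i) i = 1
  · rw [hfi]; exact one_dvd _
  · have hle : n i ≤ (finite_dsupp f).toFinset.sup n + 1 :=
      (Finset.le_sup (f := n) ((finite_dsupp f).mem_toFinset.mpr hfi)).trans (Nat.le_succ _)
    exact (hdvd i).trans (pow_dvd_pow _ hle)

omit [DecidableEq ι] in
/-- For monoprime factors: `f ≼ g` and `g ≼ f` iff `supp f = supp g`. [cite: MochizukiFrdI2008, §0 p.12] -/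
theorem precsim_antisymm_iff (hM : ∀ i, IsMonoprime (M i)) (f g : directSum M) :
    (f ≼ g ∧ g ≼ f) ↔ dsupp (f : ∀ i, M i) = dsupp (g : ∀ i, M i) := by
  rw [precsim_iff_dsupp_subset hM, precsim_iff_dsupp_subset hM, Set.Subset.antisymm_iff]

omit [DecidableEq ι] in
/-- **`⊕_i M_i` is divisorial** for monoprime `M_i` (sharp, cancellative, and `a^n = c b^n ⇒ b ≤ a`
componentwise). [cite: MochizukiFrdI2008, Def. 1.1 (i) p.19] -/
theorem isDivisorial (hM : ∀ i, IsMonoprime (M i)) : IsDivisorial (directSum M) := by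
  have hsh : ∀ i, IsSharp (M i) := fun i => MonoprimeStructure.isSharp (hM i)
  haveI : IsCancelMul (directSum M) := isCancelMul fun i => MonoprimeStructure.isCancelMul (hM i)
  refine isDivisorial_of_dvd_of_pow (isSharp hsh) fun a b c n hn h => ?_
  rw [dvd_iff hsh]
  intro i
  have hi := congrArg (fun z : directSum M => (z : ∀ i, M i) i) h
  simp only [coe_pow, coe_mul, Pi.pow_apply, Pi.mul_apply] at hi
  exact IsMonoprime.dvd_of_pow_eq_mul_pow (hM i) hn hi

omit [DecidableEq ι] in
/-- For monoprime factors `⊕_i M_i` is sharp. [cite: MochizukiFrdI2008, §0 p.11] -/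
theorem isSharp' (hM : ∀ i, IsMonoprime (M i)) : IsSharp (directSum M) :=
  isSharp fun i => MonoprimeStructure.isSharp (hM i)

end DirectSum

end DirectSum

end Literature.AlgebraicGeometry.Frobenioids
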